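import Literature.MathematicalPhysics.QuantumFieldTheory.Federbush1986.BallSmoothing

/-!
# `Federbush1986.BallSmoothingDeriv` — [Federbush1988PhaseCellIV] Appendix A, Theorem A.3 (A.26) p. 342 for the mollification
# step: `‖D^m f^{s′}(x)‖ ≤ c_m d(x, ∂B)^{−(m−1)} Λ₁(f)` for the boundary-scale mollification `f^{s′} = smooth ε g` — PROVED

statement-level skeleton of published theorems with citation tags; proofs where landed; nothing here is a claim about the Yang–Mills mass gap

CITATION HEADER.  P. Federbush, *A phase cell approach to Yang–Mills theory. IV. The choice of variables*, Commun. Math.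
Phys. **114** (1988) 317–343 [Federbush1988PhaseCellIV], Appendix A part C, Theorem A.3 (A.25)–(A.26) and its proof
(A.27)–(A.31) p. 342 (render f4-p026 of unit `lit-balaban-r19`).  Cell `lit-balaban`, Phase-2 proof seat **p04 gen 7**;
SKELETON row **F4.ThmA.3** (decl of record `PhaseCellIVAppA.ThmA3ContCap`, p251889; fold owner r19).  Inputs BY NAME:
`LipschitzMollifier` (p258818: `norm_iteratedFDeriv_moll_succ_le`, `norm_moll_sub_le`, `exists_bound_iteratedFDeriv_kernel`),
`BallCutoffs` (`exists_psi_bound`, `exists_level`, `psi_eventuallyEq_zero_of_lt`), `BallSmoothing` (`smooth`, `partialSum`,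
`smooth_eventuallyEq_partialSum`, `hs_*`, `psi_eq_zero_below`, `psi_eventuallyEq_zero_below`).

WHAT IS PRINTED (p. 342).  Theorem A.3 b): «`|D^α f^s(x)| ≤ c_α (d(x, ∂B))^{−(|α|−1)} Λ₁(f)` (A.26)» for `f^s = Pr_M ∘ f^{s′}`,
`f^{s′}` the mollification at scale `εd(x)` (A.30); «It is easy to show that for `ε` small enough … satisfies the theorem.»
THIS FILE proves the (A.26)-shaped bounds for `f^{s′} = smooth ε g` itself (the projection `Pr_M` is composed in
`PhaseCellIVThmA3Retract`): for every `m` there is `A = A(n, m, ε)` with `‖D^i(smooth ε g)(x)‖ ≤ A·Λ₁(g)·θ(x)^{−(i−1)}` for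
`1 ≤ i ≤ m`, `|x| < 1`, where `θ(x) = 1 − |x|² ≥ d(x, ∂B)`.  MECHANISM: at a point of dyadic level `J` (`2^{−J} < θ(x) ≤
2·2^{−J}`, local scale `a = h_J = ε2^{−J} ≥ εθ(x)/2`), near `x` one has `smooth ε g = w^{a} ⋆ g + Σ_{J−2≤j≤J} ψ_j·(w^{h_j} ⋆ g −
w^{a} ⋆ g)` (all other cutoffs vanish identically near `x`); `‖D^i(w^a ⋆ g)‖ ≤ C_{i−1}Λ₁a^{−(i−1)}` (`LipschitzMollifier`),
`‖D^lψ_j‖ ≤ P2^{Jl} = Pε^l a^{−l}`, `‖w^{h_j} ⋆ g − w^a ⋆ g‖ ≤ 5Λ₁a`, `‖D^b(…)‖ ≤ 2C_{b−1}Λ₁a^{−(b−1)}`, and the Leibniz bound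
`norm_iteratedFDeriv_smul_le` combine to `const·Λ₁·a^{−(i−1)} ≤ const·(2/ε)^{i−1}·Λ₁·θ(x)^{−(i−1)}` — every derivative falling on
a cutoff costs `a^{−1}`, exactly compensated by the one factor `a` from `‖w^{h} ⋆ g − w^{a} ⋆ g‖ = O(Λ₁a)` when all `i` derivatives
fall on the cutoff: print's «`(d(x, ∂B))^{−(|α|−1)} Λ₁(f)`».

WHAT THIS MODULE PROVIDES (namespace `BallSmoothing`): defs with bodies `Cm`, `Bc`, `Ac` (the explicit constants); theorems
`norm_iteratedFDeriv_smul_le_of_scale` (abstract Leibniz-with-scales bound), `partialSum_eq_alt`, `smooth_eventuallyEq_alt`,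
`norm_iteratedFDeriv_moll_le'`, `norm_sub_moll_le`, `norm_iteratedFDeriv_term_le`, **`norm_iteratedFDeriv_smooth_le`**,
**`exists_deriv_bound`**.  No `Prop`-valued definition, no named fact; axioms standard.
-/

namespace Literature.MathematicalPhysics.QuantumFieldTheory.Federbush1986

noncomputable section

open MeasureTheory Metric Set Filter Function
open scoped ContDiff Topology NNReal

namespace BallSmoothing

open LipschitzMollifier BallCutoffs

variable {n : ℕ} {F : Type*} [NormedAddCommGroup F] [NormedSpace ℝ F]

/-! ## §1 An abstract Leibniz bound with scales -/

/-- **Leibniz bound with scales.** If `‖D^lψ(x)‖ ≤ Q_l a^{−l}` (`l ≤ i`), `‖v(x)‖ ≤ R₀a` and `‖D^b v(x)‖ ≤ R_b a^{−(b−1)}`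
(`1 ≤ b ≤ i`), then `‖D^i(ψ·v)(x)‖ ≤ (Σ_{l<i} C(i,l)Q_lR_{i−l} + Q_iR₀)·a^{−(i−1)}` (`i ≥ 1`): the homogeneity count behind
(A.26). [cite: Federbush1988PhaseCellIV, Theorem A.3 (A.26) p. 342] -/
theorem norm_iteratedFDeriv_smul_le_of_scale {ψ : Euc n → ℝ} {v : Euc n → F} (hψ : ContDiff ℝ ∞ ψ) (hv : ContDiff ℝ ∞ v)
    {i : ℕ} (hi : 1 ≤ i) {a : ℝ} (ha : 0 < a) {Q R : ℕ → ℝ} {R₀ : ℝ} {x : Euc n}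
    (hQ : ∀ l ≤ i, ‖iteratedFDeriv ℝ l ψ x‖ ≤ Q l * (a⁻¹) ^ l) (hR0 : ‖v x‖ ≤ R₀ * a)
    (hR : ∀ b, 1 ≤ b → b ≤ i → ‖iteratedFDeriv ℝ b v x‖ ≤ R b * (a⁻¹) ^ (b - 1)) :
    ‖iteratedFDeriv ℝ i (fun y => ψ y • v y) x‖ ≤
      ((∑ l ∈ Finset.range i, (i.choose l : ℝ) * Q l * R (i - l)) + Q i * R₀) * (a⁻¹) ^ (i - 1) := by
  obtain ⟨k, rfl⟩ := Nat.exists_eq_add_of_le' hi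
  have hLeib := norm_iteratedFDeriv_smul_le hψ hv x (n := k + 1) (mod_cast le_top)
  refine hLeib.trans ?_
  rw [Finset.sum_range_succ, Nat.choose_self, Nat.cast_one, one_mul, Nat.sub_self, norm_iteratedFDeriv_zero,
    Nat.add_sub_cancel, add_mul, Finset.sum_mul]
  refine add_le_add (Finset.sum_le_sum fun l hl => ?_) ?_
  · rw [Finset.mem_range] at hl
    have hQl := hQ l (by omega)
    have hRl := hR (k + 1 - l) (by omega) (by omega)
    have hQ0 : 0 ≤ Q l * (a⁻¹) ^ l := (norm_nonneg _).trans hQl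
    calc ((k + 1).choose l : ℝ) * ‖iteratedFDeriv ℝ l ψ x‖ * ‖iteratedFDeriv ℝ (k + 1 - l) v x‖
        ≤ ((k + 1).choose l : ℝ) * (Q l * (a⁻¹) ^ l) * (R (k + 1 - l) * (a⁻¹) ^ (k + 1 - l - 1)) := by
          refine mul_le_mul (mul_le_mul_of_nonneg_left hQl (by positivity)) hRl (norm_nonneg _) (by positivity)
      _ = ((k + 1).choose l : ℝ) * Q l * R (k + 1 - l) * ((a⁻¹) ^ l * (a⁻¹) ^ (k + 1 - l - 1)) := by ring
      _ = ((k + 1).choose l : ℝ) * Q l * R (k + 1 - l) * (a⁻¹) ^ (k + 1 - 1) := by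
          rw [← pow_add]; congr 2; omega
  · have hQi := hQ (k + 1) le_rfl
    have hQ0 : 0 ≤ Q (k + 1) * (a⁻¹) ^ (k + 1) := (norm_nonneg _).trans hQi
    calc ‖iteratedFDeriv ℝ (k + 1) ψ x‖ * ‖v x‖ ≤ (Q (k + 1) * (a⁻¹) ^ (k + 1)) * (R₀ * a) :=
          mul_le_mul hQi hR0 (norm_nonneg _) hQ0
      _ = Q (k + 1) * R₀ * ((a⁻¹) ^ k * (a⁻¹ * a)) := by rw [pow_succ]; ring
      _ = Q (k + 1) * R₀ * (a⁻¹) ^ (k + 1 - 1) := by rw [inv_mul_cancel₀ ha.ne', mul_one, Nat.add_sub_cancel]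

/-! ## §2 The local representation around a point of level `J` -/

/-- The re-centred local form `w^{h_J} ⋆ g + Σ_{j≤J} ψ_j·(w^{h_j} ⋆ g − w^{h_J} ⋆ g)`. [cite: Federbush1988PhaseCellIV, (A.30)
p. 342] -/
def alt (ε : ℝ) (g : Euc n → F) (J : ℕ) (y : Euc n) : F :=
  moll g (hs ε J) y + ∑ j ∈ Finset.range (J + 1), psi j y • (moll g (hs ε j) y - moll g (hs ε J) y)

/-- On `{θ > 2^{−J}}` the local finite form equals the re-centred one (partition of unity).
[cite: Federbush1988PhaseCellIV, (A.30) p. 342] -/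
theorem partialSum_eq_alt {ε : ℝ} {g : Euc n → F} {J : ℕ} {y : Euc n} (hJ : (1 / 2 : ℝ) ^ J < theta y) :
    partialSum ε g J y = alt ε g J y := by
  have hone : ∑ j ∈ Finset.range (J + 1), psi j y = 1 := by
    apply sum_psi_eq_one
    have hθ : 0 < theta y := lt_of_le_of_lt (by positivity) hJ
    have h2 : (2 : ℝ) ^ (J + 1) * (1 / 2 : ℝ) ^ J = 2 := by
      rw [pow_succ, mul_assoc, mul_comm 2, ← mul_assoc, ← mul_pow]; norm_num
    calc (2 : ℝ) = 2 ^ (J + 1) * (1 / 2 : ℝ) ^ J := h2.symm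
      _ ≤ 2 ^ (J + 1) * theta y := mul_le_mul_of_nonneg_left hJ.le (by positivity)
  unfold partialSum alt
  simp only [smul_sub, Finset.sum_sub_distrib, ← Finset.sum_smul, hone, one_smul]
  abel

/-- Near a point of level `J`, `f^{s′}` is the re-centred local form. [cite: Federbush1988PhaseCellIV, (A.30) p. 342] -/
theorem smooth_eventuallyEq_alt {ε : ℝ} {g : Euc n → F} {J : ℕ} {x : Euc n} (hJ : (1 / 2 : ℝ) ^ J < theta x) :
    smooth ε g =ᶠ[𝓝 x] alt ε g J := by
  filter_upwards [smooth_eventuallyEq_partialSum (ε := ε) (g := g) hJ,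
    continuousAt_const.eventually_lt continuous_theta.continuousAt hJ] with y hy hy'
  rw [hy, partialSum_eq_alt hy']

/-! ## §3 The constants and the ingredients of the bound -/

/-- `C_k := vol(B_{1+k})·sup‖D^k w‖` — the constant of `‖D^{k+1}(w^h ⋆ g)‖ ≤ C_kΛ₁h^{−k}`. [cite: Federbush1988PhaseCellIV,
(A.26)/(A.30) p. 342] -/
def Cm (n : ℕ) (Ak : ℕ → ℝ) (k : ℕ) : ℝ := vB n (1 + k) * Ak k

/-- The constant of one shell term `ψ_j·(w^{h_j} ⋆ g − w^{h_J} ⋆ g)`. [cite: Federbush1988PhaseCellIV, (A.26) p. 342] -/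
def Bc (n : ℕ) (P : ℝ) (Ak : ℕ → ℝ) (ε : ℝ) (i : ℕ) : ℝ :=
  (∑ l ∈ Finset.range i, (i.choose l : ℝ) * (P * ε ^ l) * (2 * Cm n Ak (i - l - 1))) + P * ε ^ i * 5

/-- The constant `c_i` of (A.26) for `f^{s′}` (before the projection), in terms of `θ(x) ≥ d(x, ∂B)`.
[cite: Federbush1988PhaseCellIV, Theorem A.3 (A.26) p. 342] -/
def Ac (n : ℕ) (P : ℝ) (Ak : ℕ → ℝ) (ε : ℝ) (i : ℕ) : ℝ := (Cm n Ak (i - 1) + 3 * Bc n P Ak ε i) * (2 / ε) ^ (i - 1)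

/-- `C_k ≥ 0`. [cite: Federbush1988PhaseCellIV, (A.26) p. 342] -/
theorem Cm_nonneg {Ak : ℕ → ℝ} (hAk : ∀ k, 0 ≤ Ak k) (k : ℕ) : 0 ≤ Cm n Ak k :=
  mul_nonneg (vB_nonneg _ _) (hAk k)

/-- `Bc ≥ 0`. [cite: Federbush1988PhaseCellIV, (A.26) p. 342] -/
theorem Bc_nonneg {P : ℝ} (hP : 0 ≤ P) {Ak : ℕ → ℝ} (hAk : ∀ k, 0 ≤ Ak k) {ε : ℝ} (hε : 0 < ε) (i : ℕ) :
    0 ≤ Bc n P Ak ε i := by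
  unfold Bc
  refine add_nonneg (Finset.sum_nonneg fun l _ => ?_) (by positivity)
  have := Cm_nonneg (n := n) hAk (i - l - 1)
  positivity

/-- `Ac ≥ 0`. [cite: Federbush1988PhaseCellIV, (A.26) p. 342] -/
theorem Ac_nonneg {P : ℝ} (hP : 0 ≤ P) {Ak : ℕ → ℝ} (hAk : ∀ k, 0 ≤ Ak k) {ε : ℝ} (hε : 0 < ε) (i : ℕ) :
    0 ≤ Ac n P Ak ε i := by
  unfold Ac
  have h1 := Cm_nonneg (n := n) hAk (i - 1)
  have h2 := Bc_nonneg (n := n) hP hAk hε i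
  positivity

/-- `‖D^i(w^h ⋆ g)(x)‖ ≤ C_{i−1}Λ₁(g)h^{−(i−1)}` for `i ≥ 1` (from `LipschitzMollifier`). [cite: Federbush1988PhaseCellIV,
(A.26)/(A.30) p. 342] -/
theorem norm_iteratedFDeriv_moll_le' {Ak : ℕ → ℝ} (hAk : ∀ k t, ‖iteratedFDeriv ℝ k (kernel n) t‖ ≤ Ak k)
    {g : Euc n → F} {K : ℝ≥0} (hg : LipschitzWith K g) {h : ℝ} (hh : 0 < h) {i : ℕ} (hi : 1 ≤ i) (x : Euc n) :
    ‖iteratedFDeriv ℝ i (moll g h) x‖ ≤ Cm n Ak (i - 1) * K * (h⁻¹) ^ (i - 1) := by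
  obtain ⟨k, rfl⟩ := Nat.exists_eq_add_of_le' hi
  rw [Nat.add_sub_cancel]
  exact norm_iteratedFDeriv_moll_succ_le hg hh k (hAk k) x

/-- The zero-order gain: `‖(w^{h_j} ⋆ g − w^{h_J} ⋆ g)(x)‖ ≤ 5Λ₁(g)h_J` for `J ≤ j + 2`.
[cite: Federbush1988PhaseCellIV, (A.26)/(A.30) p. 342] -/
theorem norm_sub_moll_le [CompleteSpace F] {ε : ℝ} (hε : 0 < ε) {g : Euc n → F} {K : ℝ≥0} (hg : LipschitzWith K g)
    {J j : ℕ} (hj : J ≤ j + 2) (x : Euc n) :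
    ‖moll g (hs ε j) x - moll g (hs ε J) x‖ ≤ 5 * K * hs ε J := by
  have h1 := norm_moll_sub_le hg (hs_pos hε j) x
  have h2 := norm_moll_sub_le hg (hs_pos hε J) x
  have h3 := hs_le_four_mul hε hj
  calc ‖moll g (hs ε j) x - moll g (hs ε J) x‖
      ≤ ‖moll g (hs ε j) x - g x‖ + ‖g x - moll g (hs ε J) x‖ := norm_sub_le_norm_sub_add_norm_sub _ _ _
    _ ≤ K * hs ε j + K * hs ε J := by rw [norm_sub_rev (g x)]; exact add_le_add h1 h2
    _ ≤ K * (4 * hs ε J) + K * hs ε J := by gcongr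
    _ = 5 * K * hs ε J := by ring

/-- **One shell term.** For `j ≤ J ≤ j + 2` at a point of level `J`: `‖D^i(ψ_j·(w^{h_j} ⋆ g − w^{h_J} ⋆ g))(x)‖ ≤
Bc_i·Λ₁(g)·h_J^{−(i−1)}`. [cite: Federbush1988PhaseCellIV, Theorem A.3 (A.26) p. 342] -/
theorem norm_iteratedFDeriv_term_le [CompleteSpace F] {ε : ℝ} (hε : 0 < ε) {m : ℕ} {P : ℝ}
    (hP : ∀ j l, l ≤ m → ∀ x ∈ closedBall (0 : Euc n) 1, ‖iteratedFDeriv ℝ l (psi j : Euc n → ℝ) x‖ ≤ P * 2 ^ (j * l))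
    {Ak : ℕ → ℝ} (hAk : ∀ k t, ‖iteratedFDeriv ℝ k (kernel n) t‖ ≤ Ak k)
    {g : Euc n → F} {K : ℝ≥0} (hg : LipschitzWith K g) {i : ℕ} (hi1 : 1 ≤ i) (him : i ≤ m)
    {x : Euc n} (hx : x ∈ closedBall (0 : Euc n) 1) {J j : ℕ} (hjJ : j ≤ J) (hJj : J ≤ j + 2) :
    ‖iteratedFDeriv ℝ i (fun y => psi j y • (moll g (hs ε j) y - moll g (hs ε J) y)) x‖ ≤
      Bc n P Ak ε i * K * ((hs ε J)⁻¹) ^ (i - 1) := by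
  set a := hs ε J with ha_def
  have ha : 0 < a := hs_pos hε J
  have hgc : Continuous g := hg.continuous
  have hv : ContDiff ℝ ∞ fun y => moll g (hs ε j) y - moll g (hs ε J) y := (contDiff_moll hgc _).sub (contDiff_moll hgc _)
  -- the three families of bounds
  have hQ : ∀ l ≤ i, ‖iteratedFDeriv ℝ l (psi j : Euc n → ℝ) x‖ ≤ (P * ε ^ l) * (a⁻¹) ^ l := by
    intro l hl
    refine (hP j l (hl.trans him) x hx).trans ?_
    have h2j : (2 : ℝ) ^ (j * l) ≤ 2 ^ (J * l) := pow_le_pow_right₀ (by norm_num) (Nat.mul_le_mul_right l hjJ)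
    have h2J : (2 : ℝ) ^ (J * l) = ε ^ l * (a⁻¹) ^ l := by rw [pow_mul, two_pow_eq hε J, mul_pow]
    have hP0 : 0 ≤ P := by
      have := (norm_nonneg _).trans (hP j 0 (Nat.zero_le m) x hx)
      simpa using this
    calc P * (2 : ℝ) ^ (j * l) ≤ P * 2 ^ (J * l) := mul_le_mul_of_nonneg_left h2j hP0
      _ = P * ε ^ l * (a⁻¹) ^ l := by rw [h2J, mul_assoc]
  have hR0 : ‖moll g (hs ε j) x - moll g (hs ε J) x‖ ≤ (5 * K) * a := norm_sub_moll_le hε hg hJj x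
  have hR : ∀ b, 1 ≤ b → b ≤ i →
      ‖iteratedFDeriv ℝ b (fun y => moll g (hs ε j) y - moll g (hs ε J) y) x‖ ≤ (2 * Cm n Ak (b - 1) * K) * (a⁻¹) ^ (b - 1) := by
    intro b hb1 _
    have hfun : (fun y => moll g (hs ε j) y - moll g (hs ε J) y) = moll g (hs ε j) - moll g (hs ε J) := rfl
    rw [hfun, iteratedFDeriv_sub_apply ((contDiff_moll hgc _).of_le (mod_cast le_top)).contDiffAt
      ((contDiff_moll hgc _).of_le (mod_cast le_top)).contDiffAt]
    have h1 := norm_iteratedFDeriv_moll_le' hAk hg (hs_pos hε j) hb1 x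
    have h2 := norm_iteratedFDeriv_moll_le' hAk hg ha hb1 x
    have hja : a ≤ hs ε j := hs_mono hε hjJ
    have hinv : (hs ε j)⁻¹ ^ (b - 1) ≤ (a⁻¹) ^ (b - 1) :=
      pow_le_pow_left₀ (inv_nonneg.2 (hs_pos hε j).le) ((inv_le_inv₀ (hs_pos hε j) ha).2 hja) _
    have hC0 : 0 ≤ Cm n Ak (b - 1) * K :=
      mul_nonneg (mul_nonneg (vB_nonneg _ _) ((norm_nonneg _).trans (hAk (b - 1) 0))) K.coe_nonneg
    calc ‖iteratedFDeriv ℝ b (moll g (hs ε j)) x - iteratedFDeriv ℝ b (moll g (hs ε J)) x‖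
        ≤ ‖iteratedFDeriv ℝ b (moll g (hs ε j)) x‖ + ‖iteratedFDeriv ℝ b (moll g (hs ε J)) x‖ := norm_sub_le _ _
      _ ≤ Cm n Ak (b - 1) * K * (hs ε j)⁻¹ ^ (b - 1) + Cm n Ak (b - 1) * K * (a⁻¹) ^ (b - 1) := add_le_add h1 h2
      _ ≤ Cm n Ak (b - 1) * K * (a⁻¹) ^ (b - 1) + Cm n Ak (b - 1) * K * (a⁻¹) ^ (b - 1) := by gcongr
      _ = 2 * Cm n Ak (b - 1) * K * (a⁻¹) ^ (b - 1) := by ring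
  have key := norm_iteratedFDeriv_smul_le_of_scale (contDiff_psi j) hv hi1 ha (Q := fun l => P * ε ^ l)
    (R := fun b => 2 * Cm n Ak (b - 1) * K) hQ hR0 hR
  refine key.trans (le_of_eq ?_)
  unfold Bc
  rw [add_mul _ _ (K : ℝ), Finset.sum_mul]
  congr 1
  congr 1
  · refine Finset.sum_congr rfl fun l _ => ?_
    ring
  · ring

/-! ## §4 The main estimate -/

/-- **(A.26) for `f^{s′}`, explicit constants.** For `x` in the open ball and `1 ≤ i ≤ m`:
`‖D^i(smooth ε g)(x)‖ ≤ Ac_i·Λ₁(g)·θ(x)^{−(i−1)}`. [cite: Federbush1988PhaseCellIV, Theorem A.3 (A.26) p. 342] -/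
theorem norm_iteratedFDeriv_smooth_le [CompleteSpace F] {ε : ℝ} (hε : 0 < ε) {m : ℕ} {P : ℝ} (hP0 : 0 ≤ P)
    (hP : ∀ j l, l ≤ m → ∀ x ∈ closedBall (0 : Euc n) 1, ‖iteratedFDeriv ℝ l (psi j : Euc n → ℝ) x‖ ≤ P * 2 ^ (j * l))
    {Ak : ℕ → ℝ} (hAk0 : ∀ k, 0 ≤ Ak k) (hAk : ∀ k t, ‖iteratedFDeriv ℝ k (kernel n) t‖ ≤ Ak k)
    {g : Euc n → F} {K : ℝ≥0} (hg : LipschitzWith K g) {i : ℕ} (hi1 : 1 ≤ i) (him : i ≤ m)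
    {x : Euc n} (hx : x ∈ ball (0 : Euc n) 1) :
    ‖iteratedFDeriv ℝ i (smooth ε g) x‖ ≤ Ac n P Ak ε i * K * ((theta x)⁻¹) ^ (i - 1) := by
  have hθ : 0 < theta x := theta_pos hx
  have hxc : x ∈ closedBall (0 : Euc n) 1 := ball_subset_closedBall hx
  obtain ⟨J, _, hJlt, hJle⟩ := exists_level hθ (theta_le_one x)
  set a := hs ε J with ha_def
  have ha : 0 < a := hs_pos hε J
  have hgc : Continuous g := hg.continuous
  -- Step 1: pass to the re-centred local form
  rw [((smooth_eventuallyEq_alt (ε := ε) (g := g) hJlt).iteratedFDeriv ℝ i).eq_of_nhds]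
  have hmollJ : ContDiff ℝ ∞ (moll g a) := contDiff_moll hgc _
  have hterm : ∀ j, ContDiff ℝ ∞ fun y => psi j y • (moll g (hs ε j) y - moll g (hs ε J) y) := fun j =>
    (contDiff_psi j).smul ((contDiff_moll hgc _).sub (contDiff_moll hgc _))
  have hsplit : iteratedFDeriv ℝ i (alt ε g J) x = iteratedFDeriv ℝ i (moll g a) x +
      ∑ j ∈ Finset.range (J + 1), iteratedFDeriv ℝ i (fun y => psi j y • (moll g (hs ε j) y - moll g (hs ε J) y)) x := by
    have hsum : ContDiff ℝ ∞ fun y => ∑ j ∈ Finset.range (J + 1), psi j y • (moll g (hs ε j) y - moll g (hs ε J) y) :=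
      ContDiff.sum fun j _ => hterm j
    unfold alt
    rw [fun_iteratedFDeriv_add_apply (hmollJ.of_le (mod_cast le_top)).contDiffAt (hsum.of_le (mod_cast le_top)).contDiffAt,
      iteratedFDeriv_fun_sum_apply fun j _ => ((hterm j).of_le (mod_cast le_top)).contDiffAt]
  rw [hsplit]
  -- Step 2: the re-centred mollifier
  have h1 : ‖iteratedFDeriv ℝ i (moll g a) x‖ ≤ Cm n Ak (i - 1) * K * (a⁻¹) ^ (i - 1) :=
    norm_iteratedFDeriv_moll_le' hAk hg ha hi1 x
  -- Step 3: the shell terms — only `j ∈ Icc (J-2) J` survive near `x`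
  have hsub : Finset.Icc (J - 2) J ⊆ Finset.range (J + 1) := by
    intro j hj; rw [Finset.mem_Icc] at hj; rw [Finset.mem_range]; omega
  have hvanish : ∀ j ∈ Finset.range (J + 1), j ∉ Finset.Icc (J - 2) J →
      iteratedFDeriv ℝ i (fun y => psi j y • (moll g (hs ε j) y - moll g (hs ε J) y)) x = 0 := by
    intro j hj hj'
    rw [Finset.mem_range] at hj
    rw [Finset.mem_Icc, not_and_or, not_le, not_le] at hj'
    have hj3 : j + 3 ≤ J := by omega
    have hev : (fun y => psi j y • (moll g (hs ε j) y - moll g (hs ε J) y)) =ᶠ[𝓝 x] fun _ => (0 : F) := by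
      filter_upwards [psi_eventuallyEq_zero_below hJle hj3] with y hy
      rw [hy, zero_smul]
    rw [(hev.iteratedFDeriv ℝ i).eq_of_nhds, iteratedFDeriv_fun_zero, Pi.zero_apply]
  rw [← Finset.sum_subset hsub hvanish]
  have h2 : ∀ j ∈ Finset.Icc (J - 2) J,
      ‖iteratedFDeriv ℝ i (fun y => psi j y • (moll g (hs ε j) y - moll g (hs ε J) y)) x‖ ≤
        Bc n P Ak ε i * K * (a⁻¹) ^ (i - 1) := by
    intro j hj
    rw [Finset.mem_Icc] at hj
    exact norm_iteratedFDeriv_term_le hε hP hAk hg hi1 him hxc hj.2 (by omega)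
  have hcard : (Finset.Icc (J - 2) J).card ≤ 3 := by rw [Nat.card_Icc]; omega
  have hB0 : 0 ≤ Bc n P Ak ε i * K * (a⁻¹) ^ (i - 1) := by
    have := Bc_nonneg (n := n) hP0 hAk0 hε i; positivity
  have h3 : ‖∑ j ∈ Finset.Icc (J - 2) J,
      iteratedFDeriv ℝ i (fun y => psi j y • (moll g (hs ε j) y - moll g (hs ε J) y)) x‖ ≤
        3 * (Bc n P Ak ε i * K * (a⁻¹) ^ (i - 1)) := by
    refine (norm_sum_le _ _).trans ((Finset.sum_le_card_nsmul _ _ _ h2).trans ?_)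
    rw [nsmul_eq_mul]
    exact mul_le_mul_of_nonneg_right (by exact_mod_cast hcard) hB0
  -- Step 4: the local scale `a = h_J ≥ εθ(x)/2`
  have hscale : (a⁻¹) ^ (i - 1) ≤ (2 / ε) ^ (i - 1) * ((theta x)⁻¹) ^ (i - 1) := by
    rw [← mul_pow]
    refine pow_le_pow_left₀ (inv_nonneg.2 ha.le) ?_ _
    have hεθ : ε * theta x / 2 ≤ a := by
      rw [ha_def, hs]
      nlinarith
    calc a⁻¹ ≤ (ε * theta x / 2)⁻¹ := (inv_le_inv₀ ha (by positivity)).2 hεθ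
      _ = 2 / ε * (theta x)⁻¹ := by field_simp
  have hC0 : 0 ≤ (Cm n Ak (i - 1) + 3 * Bc n P Ak ε i) * K := by
    have := Cm_nonneg (n := n) hAk0 (i - 1)
    have := Bc_nonneg (n := n) hP0 hAk0 hε i
    positivity
  calc ‖iteratedFDeriv ℝ i (moll g a) x + ∑ j ∈ Finset.Icc (J - 2) J,
        iteratedFDeriv ℝ i (fun y => psi j y • (moll g (hs ε j) y - moll g (hs ε J) y)) x‖
      ≤ Cm n Ak (i - 1) * K * (a⁻¹) ^ (i - 1) + 3 * (Bc n P Ak ε i * K * (a⁻¹) ^ (i - 1)) :=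
        (norm_add_le _ _).trans (add_le_add h1 h3)
    _ = ((Cm n Ak (i - 1) + 3 * Bc n P Ak ε i) * K) * (a⁻¹) ^ (i - 1) := by ring
    _ ≤ ((Cm n Ak (i - 1) + 3 * Bc n P Ak ε i) * K) * ((2 / ε) ^ (i - 1) * ((theta x)⁻¹) ^ (i - 1)) :=
        mul_le_mul_of_nonneg_left hscale hC0
    _ = Ac n P Ak ε i * K * ((theta x)⁻¹) ^ (i - 1) := by unfold Ac; ring

/-- **Theorem A.3 (A.26) for `f^{s′}` (before the projection).** For every dimension `n`, every order cap `m` and every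
`ε > 0` there is `A = A(n, m, ε) ≥ 0` such that for EVERY `Λ₁`-Lipschitz `g : ℝⁿ → F`, every `1 ≤ i ≤ m` and every `x` in the
open unit ball, `‖D^i(smooth ε g)(x)‖ ≤ A·Λ₁·θ(x)^{−(i−1)}` (with `θ(x) ≥ d(x, ∂B)`, so a fortiori the printed
`c_α d(x, ∂B)^{−(|α|−1)} Λ₁(f)`). [cite: Federbush1988PhaseCellIV, Theorem A.3 (A.26) p. 342] -/
theorem exists_deriv_bound [CompleteSpace F] (m : ℕ) {ε : ℝ} (hε : 0 < ε) : ∃ A : ℝ, 0 ≤ A ∧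
    ∀ (g : Euc n → F) (K : ℝ≥0), LipschitzWith K g → ∀ i, 1 ≤ i → i ≤ m →
    ∀ x ∈ ball (0 : Euc n) 1, ‖iteratedFDeriv ℝ i (smooth ε g) x‖ ≤ A * K * ((theta x)⁻¹) ^ (i - 1) := by
  obtain ⟨P, hP0, hP⟩ := exists_psi_bound (n := n) m
  have hker : ∀ k, ∃ A : ℝ, 0 ≤ A ∧ ∀ t : Euc n, ‖iteratedFDeriv ℝ k (kernel n) t‖ ≤ A := fun k =>
    exists_bound_iteratedFDeriv_kernel (n := n) k
  choose Ak hAk0 hAk using hker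
  refine ⟨∑ i ∈ Finset.range (m + 1), Ac n P Ak ε i, Finset.sum_nonneg fun i _ => Ac_nonneg hP0 hAk0 hε i,
    fun g K hg i hi1 him x hx => ?_⟩
  have hle : Ac n P Ak ε i ≤ ∑ i ∈ Finset.range (m + 1), Ac n P Ak ε i :=
    Finset.single_le_sum (fun i _ => Ac_nonneg hP0 hAk0 hε i) (by rw [Finset.mem_range]; omega)
  calc ‖iteratedFDeriv ℝ i (smooth ε g) x‖ ≤ Ac n P Ak ε i * K * ((theta x)⁻¹) ^ (i - 1) :=
        norm_iteratedFDeriv_smooth_le hε hP0 hP hAk0 hAk hg hi1 him hx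
    _ ≤ (∑ i ∈ Finset.range (m + 1), Ac n P Ak ε i) * K * ((theta x)⁻¹) ^ (i - 1) := by
        have hθ := (theta_pos hx).le
        gcongr

end BallSmoothing

end

end Literature.MathematicalPhysics.QuantumFieldTheory.Federbush1986
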